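import Mathlib
import Literature.MathematicalPhysics.QuantumFieldTheory.Balaban1983to89.B12Beta
import Literature.MathematicalPhysics.QuantumFieldTheory.Balaban1983to89.B6BondElimination
import Literature.MathematicalPhysics.QuantumFieldTheory.Balaban1983to89.B12Sec2to5
import Literature.MathematicalPhysics.QuantumFieldTheory.Balaban1983to89.Beta.OneLoop

/-!
# `Balaban1983to89.Beta.PolarizationSign` — β sub-cell, kernel node BETA-an2-LEMMA52-KERNEL (row an2's hand-over (k3),
`BETA/AN2-pv09.md` §9): the SIGN and the SECOND-MOMENT FORMULA of the coefficient `β` of (1.22)/(5.16), as theorems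
about ANY lattice kernel `P : B12Beta.Kernel d` (`= Fin d → Fin d → (ℤ^d → ℝ)`) having the properties PRINTED on p. 293
of [Balaban1987RG1] — reflection covariance (5.7)–(5.8), the Ward identity (5.9), the decay (5.10) — together with
positive semi-definiteness of its convolution form.

HONEST FRAMING (BETA-SPEC.md: discharging `BetaPertH` would make Bałaban's UV stability unconditional — a constructive-QFT
statement, NOT the continuum limit and NOT the Clay problem).  THIS MODULE ASSERTS NOTHING about Bałaban's
vacuum-polarization tensor `Π^{(j)}_{μν}`: every printed property enters as a PREDICATE on an abstract kernel
(`WardTransversal`, `AxisReflectionCovariant`, `IndexSymmetric`, `MomentSummable` / the cell's `B12Sec2to5.Decay510`,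
`ConvPSD`, `TorusConvPSD`) and is used only as a HYPOTHESIS; the conclusions are kernel-checked theorems of elementary
lattice Fourier analysis (summation by parts, Bochner's inequality on cubes, dominated convergence).  In particular the
PSD hypothesis `ConvPSD` is NOT a printed statement of B12 about the full `Π`: it is hypothesis (ii) of the
programme-internal "Lemma 5.2" of `run/shared/lean/pub/pub-balaban/BETA/AN2-pv09.md` (= (a) of "Lemma T",
`BETA/AN2.md` §4.2), which those prose files assert for structurally signed one-loop pieces on the strength of the cell's
`Beta/LogDetVariation.lean`; those files are NOT cited as sources of facts here (cell rule: programme-internal claims are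
never citable) — the CONCLUSION of their Lemma 5.2 / Lemma T ("β = Σ_x Π₁₂(x) x₁ x₂ (= (1.22)), and β ≥ 0") is PROVED
below from the stated hypotheses, for the model.  Value = the kernel certificate of the bookkeeping implication
"(5.7)–(5.10) + PSD ⇒ β ≥ 0 ∧ β = −½ Σ_z Π_{νν}(z) z_μ²" and of the DAG edge it induces, `Step.BetaLower 0 γ β`
(`β_j ≥ 0`; NOT the positive lower bound `b > 0` = asymptotic freedom, GAPS G1, which is untouched).  NOT summit progress.

CITATION HEADER (lean-in-tree rule 2026-08-18; CONTEXT ONLY — nothing of the paper is restated as a fact).  T. Bałaban,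
*Renormalization group approach to lattice gauge field theories. I. Generation of effective actions in a small field
approximation and a coupling constant renormalization in four dimensions*, Commun. Math. Phys. **109**, 249–301 (1987)
[Balaban1987RG1] (cell paper B12; held `paper:balaban1987-cmp109-rg-i-small-field`; journal page = PDF page + 248; p. 293
read by this unit from the x2 render `pages/1987-cmp109-rg-I-small-field-p045-x2.png`, p. 264 as quoted in `B12Beta.lean`):
* p. 293 [PDF 45], (5.7): *"If r is a reflection in a part of the components of x: rx = εx, (εx)_μ = ε_μ x_μ, ε_μ = ±1,
  μ = 1, …, d, then (5.4) can be written as Π(⟨εx, εx + ε_μ e_μ⟩, ⟨εy, εy + ε_ν e_ν⟩) = Π(⟨x, x + e_μ⟩, ⟨y, y + e_ν⟩).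
  This and the definition (5.5) yield Π_{μν}(εx − ((1 − ε_μ)/2) e_μ, εy − ((1 − ε_ν)/2) e_ν) = ε_μ ε_ν Π_{μν}(x, y).
  (5.7)"* — typed, for the reflection of ONE axis `α` and in the difference variable, as `AxisReflectionCovariant`.
* p. 293, (5.8): *"The function Π is also translation invariant and symmetric, hence Π_{μν}(x, y) = Π_{μν}(x − y),
  Π_{μν}(x) = Π_{νμ}(−x). (5.8)"* — translation invariance is built into the type `B12Beta.Kernel` ((1.21) p. 264); the
  second identity is `IndexSymmetric`.
* p. 293, (5.9): *"The gauge invariance, expressed in the first identity (4.15), implies Σ_μ ∂*_μ Π_{μν}(x − y) =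
  Σ_ν ∂_ν Π_{μν}(x − y) = 0. (5.9)"*; its momentum form (5.15) *"Σ_μ ∂_μ(−ζ) Π_{μν}(ζ) = Σ_ν ∂_ν(ζ) Π_{μν}(ζ) = 0, (5.15)
  where ∂_μ(ζ) = e^{iζ_μ} − 1"* with (5.11) *"Π_{μν}(p) = Σ_{x∈Z⁴} e^{−ip·x} Π_{μν}(x)"* fixes the reading of `∂*_μ` on
  the site variable: `Σ_μ [Π_{μν}(z − e_μ) − Π_{μν}(z)] = 0` for all `z` — `WardTransversal` (the first identity; the
  second follows from it under (5.8) and is not needed).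
* p. 293, (5.10): *"The representation (4.37) yields the following inequality |Π_{μν}(x − y)| ≤ O(1)E₀ exp(−δ₁|x − y|),
  (5.10) with a positive constant δ₁ determined by δ₀, κ, and M"* — the cell's `B12Sec2to5.Decay510` (sub-cell B12s),
  used BY NAME in §7; §§2–6 use only its consequence `MomentSummable P 3` (summable third polynomial moments).
* p. 293, the programme behind the β sub-cell's Lemma 5.2: *"We will analyze this function using the above properties
  only. Our goal is to prove a representation of the form (4.41), more exactly of the form
  Π_{μν}(p) = β(δ_{μν} Δ(p) − \overline{∂_μ(p)} ∂_ν(p)) + (terms of higher orders in derivatives ∂(p), \overline{∂(p)}),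
  (5.16) and to find the coefficient β."*
* p. 264 [PDF 16], (1.22) (verbatim in `B12Beta.lean`, whose `B12Beta.secondMoment` is used BY NAME): *"β_{j+1}(g_j) =
  −(∂²/∂p_μ∂p_ν Π̃_{j+1,μν})(g_j, 0) = Σ_x Π_{j+1,μν}(g_j, x) x_μ x_ν for μ, ν arbitrary, μ ≠ ν"*.
The printed text displays neither a proof that `β ≥ 0` nor the identity `β = −½ Σ_z Π_{νν}(z) z_μ²` (`μ ≠ ν`); both are
consequences of the displayed properties plus PSD and are proved here for an abstract kernel.

PRIOR ART IN THE TREE (searched; nothing duplicated, nothing of it imported).  Bochner-type positivity exists in the tree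
only in continuum / compact-support settings: `Literature/Analysis/FunctionSpaces/BochnerProofs.lean` (Bochner's theorem,
nuclear / inner-product spaces), `Literature/Analysis/Fourier/{BoasKacNonnegLattice, BoasKacNonneg,
PosDefFunctionRieszPairing, TorusExpNonnegCoefficients}.lean`; none treats a matrix-valued kernel on `ℤ^d` or `(ℤ/s)^d`
paired with finitely supported test functions.  From the cell, BY NAME: `B12Beta.{Kernel, secondMoment}` (P12a),
`B12Sec2to5.{l1, l1_nonneg, Decay510, summable_exp_neg_l1}` (B12s), `Step.BetaLower` (STEP), `Beta.Site` (pv25,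
`Beta/OneLoop.lean`; types §8 only), `B6BondElimination.{unitVec, unitVec_apply}` (the lattice unit vectors `e_μ`).

WHAT IS PROVED (0 sorry; Mathlib + the five cell modules imported):
(1) §2 `ward_pairing` — discrete integration by parts against (5.9): `Σ_μ Σ_z P_{μν}(z) (g(z + e_μ) − g(z)) = 0` for
    weights `g` pairing summably with `P`; `tsum_eq_zero_of_ward` — `Σ_z P_{αν}(z) = 0` (`g = z_α`);
    `cubic_ward_identity` / `two_mul_secondMoment_add` — `2β_{αβ} + Σ_z P_{αβ}(z) z_β + Σ_z P_{ββ}(z) z_α² = 0`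
    (`g = z_α² z_β`, `α ≠ β`; `β_{αβ} = B12Beta.secondMoment P α β`).
(2) §3 `first_moment_eq_zero` — (5.7)–(5.8) ⇒ `Σ_z P_{αβ}(z) z_β = 0` (`α ≠ β`; re-indexing by `z ↦ εz − e_α`, no
    summability); §1 `secondMoment_comm` — (5.8) ⇒ `β_{αβ} = β_{βα}`.
(3) §4 `bochner_diag_cos` — `ConvPSD P ∧ Σ_z |P_{ββ}(z)| < ∞ ⇒ ∀ p, 0 ≤ Σ_z P_{ββ}(z) cos(p z_α)` (test functions
    `cos(p x_α) e_β`, `sin(p x_α) e_β` on the cubes `B_R`; `sum_sum_sub_eq_tsum`, the Følner ratio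
    `tendsto_overlap_div_card`, dominated convergence `R → ∞`).
(4) §5 `weighted_second_moment_nonpos` — `Σ_z Q = 0 ∧ (∀ p, 0 ≤ Σ_z Q(z) cos(p z_α)) ∧` second moments
    `⇒ Σ_z Q(z) z_α² ≤ 0` (the weight `(1 − cos px)/p² = (x²/2) sinc²(px/2)`, Tannery's theorem as `p → 0`, `p ≠ 0`).
(5) §6 `secondMoment_eq_neg_half`, `secondMoment_nonneg`, `secondMoment_nonneg_of_reflection`,
    `secondMoment_eq_neg_quarter`: `β_{αβ} = −½ Σ_z P_{ββ}(z) z_α² = −¼ Σ_z (P_{ββ}(z) z_α² + P_{αα}(z) z_β²) ≥ 0`.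
(6) §7 `momentSummable_of_decay510` ((5.10) ⇒ all polynomial moments), `secondMoment_nonneg_of_decay510`,
    `betaLower_zero_of_lemma52` — the edge to `Step.BetaLower 0 γ β` (hypothesis of `Step.B14_2_6d_of_betaNonneg`);
    compare `B12Sec2to5.betaLower_neg_of_decay510`, which from (5.10) ALONE gets only `BetaLower (−β′)`.
(7) §8 `torus_planeWave_nonneg` — on `(ℤ/s)^d`: `TorusConvPSD P ⇒ 0 ≤ Σ_z Re χ_k(z) · eᵀP(z)e` for every character
    `χ_k(z) = ZMod.toCircle (Σ_i k_i z_i)` and real vector `e` (finite Fourier form of (3)).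

SCOPE / WHAT IS NOT HERE.  (a) No claim that Bałaban's `Π^{(j)}` satisfies the hypotheses: (5.7)–(5.9) are "yielded" /
"implied" in print from (5.4), (5.5), (4.15) and are not re-derived; (5.10) is the cell's decay node (`B12Decay510*.lean`,
GAPS G-B12s-15); PSD of the full `Π` is NOT printed (PSD of the structurally signed one-loop pieces is the matrix
algebra of the cell's `Beta/LogDetVariation.lean`, whose header lists "the transversality (Ward identity) that turns a
positive semidefinite polarization piece into a nonnegative β-moment (AN2.md §4.3)" as open — supplied HERE at the kernel
level, as an implication; the signs of the remaining pieces stay the β sub-cell's open items).  (b) The torus → `ℤ^d`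
passage (infinite-volume limit p. 264; (V)/(T) of the β sub-cell, GAPS G-beta-4) is not addressed: §8 is finite-volume
positivity only, §§2–7 live on `ℤ^d`.  (c) The tensor representation (5.16) and its remainder bounds ((4.34)) are not
formalised — only the two scalar consequences the β sub-cell consumes (sign; second-moment formula).

TECHNICAL NOTE.  `∑'` over `ℤ^d = Fin d → ℤ` throughout (matching `B12Beta.secondMoment`); every exchange of a finite
sum with `∑'` and every splitting of a `∑'` is justified by an explicit `Summable` fact derived from `MomentSummable P 3`
through `MomentSummable.summable_mul` (polynomial weights `|w| ≤ C·(1 + |z|₁)³`); the two limits (`R → ∞` in §4,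
`p → 0` along `𝓝[≠] 0` in §5) are `tendsto_tsum_of_dominated_convergence`.
-/

namespace Literature.MathematicalPhysics.QuantumFieldTheory.Balaban1983to89.Beta.PolarizationSign

open Literature.MathematicalPhysics.QuantumFieldTheory.Balaban1983to89
open Filter Finset
open scoped Topology BigOperators

variable {d : ℕ}

/-! ## §0 Lattice bookkeeping on `ℤ^d` -/

-- The unit lattice vector `e_μ ∈ ℤ^d` and its components are the cell's `B6BondElimination.unitVec` /
-- `unitVec_apply` (landed), reused BY NAME.
open Literature.MathematicalPhysics.QuantumFieldTheory.Balaban1983to89.B6BondElimination (unitVec unitVec_apply)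
attribute [local simp] Literature.MathematicalPhysics.QuantumFieldTheory.Balaban1983to89.B6BondElimination.unitVec_apply

/-- A polynomial weight controlling moments: `size z = 1 + Σ_i |z_i|` (≥ 1). [folklore] -/
def size (z : Fin d → ℤ) : ℝ := 1 + ∑ i, |(z i : ℝ)|

/-- `Σ_i |z_i| ≥ 0`. [folklore] -/
theorem sum_abs_nonneg (z : Fin d → ℤ) : 0 ≤ ∑ i, |(z i : ℝ)| :=
  Finset.sum_nonneg fun _ _ => abs_nonneg _

/-- `size z ≥ 1`. [folklore] -/
theorem one_le_size (z : Fin d → ℤ) : 1 ≤ size z := by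
  unfold size; linarith [sum_abs_nonneg z]

/-- `size z > 0`. [folklore] -/
theorem size_pos (z : Fin d → ℤ) : 0 < size z := lt_of_lt_of_le one_pos (one_le_size z)

/-- `|z_i| ≤ size z`. [folklore] -/
theorem abs_apply_le_size (z : Fin d → ℤ) (i : Fin d) : |(z i : ℝ)| ≤ size z := by
  unfold size
  have h : |(z i : ℝ)| ≤ ∑ j, |(z j : ℝ)| :=
    Finset.single_le_sum (f := fun j => |(z j : ℝ)|) (fun j _ => abs_nonneg _) (Finset.mem_univ i)
  linarith

/-- `size z ≤ size z ^ n` (`n ≥ 1`). [folklore] -/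
theorem size_le_pow (z : Fin d → ℤ) {n : ℕ} (hn : n ≠ 0) : size z ≤ size z ^ n :=
  le_self_pow₀ (one_le_size z) hn

/-- `size (z + e_μ) ≤ 2 · size z`. [folklore] -/
theorem size_add_unitVec_le (z : Fin d → ℤ) (μ : Fin d) : size (z + unitVec μ) ≤ 2 * size z := by
  have h : ∑ i, |((z + unitVec μ) i : ℝ)| ≤ ∑ i, |(z i : ℝ)| + 1 := by
    have hi : ∀ i, |((z + unitVec μ) i : ℝ)| ≤ |(z i : ℝ)| + if i = μ then 1 else 0 := by
      intro i
      simp only [Pi.add_apply, unitVec_apply]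
      split_ifs with h
      · push_cast
        exact (abs_add_le _ _).trans (by simp)
      · simp
    calc ∑ i, |((z + unitVec μ) i : ℝ)| ≤ ∑ i, (|(z i : ℝ)| + if i = μ then 1 else 0) :=
          Finset.sum_le_sum fun i _ => hi i
      _ = ∑ i, |(z i : ℝ)| + 1 := by
          rw [Finset.sum_add_distrib, Finset.sum_ite_eq']; simp
  unfold size at *
  linarith [sum_abs_nonneg z]

/-! ## §1 The printed properties of the vacuum-polarization kernel as predicates on `B12Beta.Kernel d` -/

/-- (5.9) p. 293, verbatim: "The gauge invariance, expressed in the first identity (4.15), implies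
`Σ_μ ∂*_μ Π_{μν}(x − y) = Σ_ν ∂_ν Π_{μν}(x − y) = 0`."  Typed: the first (Ward) identity, with the adjoint
lattice derivative `(∂*_μ f)(z) = f(z − e_μ) − f(z)` acting on the site variable of the translation-invariant
kernel and contracted with the FIRST direction index.  (The overall sign convention of `∂*` is immaterial for
`= 0`.)  CONVENTION (lead RULING (R21), 2026-08-19; an2 CONVENTION NOTE): this predicate — like
`AxisReflectionCovariant` below — is stated in the PRINTED difference variable `z = x − y` = (base of the `μ`-bond)
− (base of the `ν`-bond) of (5.4)/(5.8); the jet formalism's kernels (`ExpKernelCalculus.hess_eq_hessKer`: `hess μ y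
ν y′ = hessKer μ ν (y′ − y)`, hence an2's `TOf`/`TbalOf`/…) are read at `−z`, so they are to be instantiated here
through `fun μ ν z => T μ ν (−z)` (an2's `flipK`), never unflipped. [cite: Balaban1987RG1, (5.9) p.293] -/
def WardTransversal (P : B12Beta.Kernel d) : Prop :=
  ∀ ν z, ∑ μ, (P μ ν (z - unitVec μ) - P μ ν z) = 0

/-- Reflection of the `α`-th coordinate: `(εz)_i = −z_i` if `i = α`, `z_i` otherwise ((5.7) p. 293:
"rx = εx, (εx)_μ = ε_μ x_μ, ε_μ = ±1" with exactly one `ε_α = −1`). [cite: Balaban1987RG1, (5.7) p.293] -/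
def axisReflect (α : Fin d) (z : Fin d → ℤ) : Fin d → ℤ := fun i => if i = α then -z i else z i

/-- Components of `εz`. [folklore] -/
@[simp] theorem axisReflect_apply (α : Fin d) (z : Fin d → ℤ) (i : Fin d) :
    axisReflect α z i = if i = α then -z i else z i := rfl

/-- `ε(εz) = z`. [folklore] -/
theorem axisReflect_axisReflect (α : Fin d) (z : Fin d → ℤ) : axisReflect α (axisReflect α z) = z := by
  funext i; by_cases h : i = α <;> simp [h]

/-- The sign `ε_μ` of the single-axis reflection of axis `α`. [cite: Balaban1987RG1, (5.7) p.293] -/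
def reflSign (α μ : Fin d) : ℝ := if μ = α then -1 else 1

/-- (5.7) p. 293, verbatim: "`Π_{μν}(εx − ((1−ε_μ)/2)e_μ, εy − ((1−ε_ν)/2)e_ν) = ε_μ ε_ν Π_{μν}(x, y)`", combined
with (5.8) "`Π_{μν}(x, y) = Π_{μν}(x − y)`", for the reflection of ONE axis `α` (so `(1−ε_μ)/2 = [μ = α]`), read
in the difference variable `z = x − y`:
`P_{μν}(εz − [μ=α]e_α + [ν=α]e_α) = ε_μ ε_ν P_{μν}(z)`.  A PREDICATE on an abstract kernel (hypothesis of the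
theorems below), not an assertion about Bałaban's `Π`.  CONVENTION: printed `z = x − y` variable — a
`hessKer`-family `T` is instantiated as `fun μ ν z => T μ ν (−z)` (see `WardTransversal`; RULING (R21)).
[cite: Balaban1987RG1, (5.7)-(5.8) p.293] -/
def AxisReflectionCovariant (P : B12Beta.Kernel d) : Prop :=
  ∀ α μ ν z,
    P μ ν (axisReflect α z - (if μ = α then unitVec α else 0) + (if ν = α then unitVec α else 0))
      = reflSign α μ * reflSign α ν * P μ ν z

/-- (5.8) p. 293, second identity, verbatim: "`Π_{μν}(x) = Π_{νμ}(−x)`" (the kernel is the Hessian of a real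
function: symmetric under the simultaneous exchange of indices and sites).  A PREDICATE.
[cite: Balaban1987RG1, (5.8) p.293] -/
def IndexSymmetric (P : B12Beta.Kernel d) : Prop :=
  ∀ μ ν x, P μ ν x = P ν μ (-x)

/-- Under (5.8) the second moment (1.22) is symmetric in the pair of directions (re-indexing `x ↦ −x`; no
summability needed). [cite: Balaban1987RG1, (5.8) p.293] -/
theorem secondMoment_comm {P : B12Beta.Kernel d} (hS : IndexSymmetric P) (α β : Fin d) :
    B12Beta.secondMoment P α β = B12Beta.secondMoment P β α := by
  unfold B12Beta.secondMoment
  rw [← (Equiv.neg (Fin d → ℤ)).tsum_eq (fun x => P β α x * (x β : ℝ) * (x α : ℝ))]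
  refine tsum_congr fun x => ?_
  rw [hS α β x]
  simp only [Equiv.neg_apply, Pi.neg_apply, Int.cast_neg]
  ring

/-- Positive semi-definiteness of the convolution form on finitely supported vector test functions
(hypothesis (ii) of `HOME/BETA/AN2-pv09.md` Lemma 5.2 / (a) of `AN2.md` Lemma T, verbatim: "PSD:
`Σ_{x,y} f_μ(x) Π_{μν}(x−y) f_ν(y) ≥ 0` for finitely supported `f`"; finitely supported = supported in a
`Finset`).  NOT printed for the full `Π`; positive semi-definiteness of the structurally signed one-loop pieces
is the subject of the cell's `Beta/LogDetVariation.lean` (tadpole / bubble-Gram forms), whose header lists the step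
"transversality (Ward identity) that turns a positive semidefinite polarization piece into a nonnegative β-moment" as
NOT there — that step is `secondMoment_nonneg` below.  A PREDICATE. [folklore] -/
def ConvPSD (P : B12Beta.Kernel d) : Prop :=
  ∀ (B : Finset (Fin d → ℤ)) (f : (Fin d → ℤ) → Fin d → ℝ),
    0 ≤ ∑ x ∈ B, ∑ y ∈ B, ∑ μ, ∑ ν, f x μ * P μ ν (x - y) * f y ν

/-- Summability of the `n`-th polynomial moments, `Σ_z |P_{μν}(z)| (1 + Σ_i|z_i|)^n < ∞` — implied for every
`n` by the exponential decay (5.10) p. 293 "`|Π_{μν}(x − y)| ≤ O(1) E₀ exp(−δ₁|x − y|)`"; only `n = 3` is used.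
A PREDICATE. [cite: Balaban1987RG1, (5.10) p.293] -/
def MomentSummable (P : B12Beta.Kernel d) (n : ℕ) : Prop :=
  ∀ μ ν, Summable fun z => |P μ ν z| * size z ^ n

/-- Comparison: a weight of polynomial growth `|w| ≤ C·size^n` pairs summably with `P`. [folklore] -/
theorem MomentSummable.summable_mul {P : B12Beta.Kernel d} {n : ℕ} (hP : MomentSummable P n)
    (μ ν : Fin d) {w : (Fin d → ℤ) → ℝ} (C : ℝ) (hw : ∀ z, |w z| ≤ C * size z ^ n) :
    Summable fun z => P μ ν z * w z := by
  refine Summable.of_norm_bounded ((hP μ ν).mul_left C) (fun z => ?_)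
  rw [Real.norm_eq_abs, abs_mul]
  calc |P μ ν z| * |w z| ≤ |P μ ν z| * (C * size z ^ n) :=
        mul_le_mul_of_nonneg_left (hw z) (abs_nonneg _)
    _ = C * (|P μ ν z| * size z ^ n) := by ring

/-! ## §2 Summation by parts against the Ward identity (exact identities on `ℤ^d`) -/

/-- Discrete integration by parts: if `Σ_μ ∂*_μ P_{μν} = 0` then `Σ_μ Σ_z P_{μν}(z) (∂_μ g)(z) = 0` for every
weight `g` pairing summably with `P` (`(∂_μ g)(z) = g(z + e_μ) − g(z)`). [folklore] -/
theorem ward_pairing (P : B12Beta.Kernel d) (hT : WardTransversal P) (ν : Fin d)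
    (g : (Fin d → ℤ) → ℝ) (h0 : ∀ μ, Summable fun z => P μ ν z * g z)
    (h1 : ∀ μ, Summable fun z => P μ ν z * g (z + unitVec μ)) :
    ∑ μ, ∑' z, P μ ν z * (g (z + unitVec μ) - g z) = 0 := by
  -- the shifted sums
  have hshift : ∀ μ, ∑' z, P μ ν (z - unitVec μ) * g z = ∑' z, P μ ν z * g (z + unitVec μ) := by
    intro μ
    have h := (Equiv.subRight (unitVec μ)).tsum_eq (fun w => P μ ν w * g (w + unitVec μ))
    simpa only [Equiv.subRight_apply, sub_add_cancel] using h
  have hsum : ∀ μ, Summable fun z => P μ ν (z - unitVec μ) * g z := by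
    intro μ
    have h := (Equiv.subRight (unitVec μ)).summable_iff.mpr (h1 μ)
    refine h.congr (fun z => ?_)
    simp only [Function.comp_apply, Equiv.subRight_apply, sub_add_cancel]
  calc ∑ μ, ∑' z, P μ ν z * (g (z + unitVec μ) - g z)
      = ∑ μ, (∑' z, P μ ν z * g (z + unitVec μ) - ∑' z, P μ ν z * g z) := by
        refine Finset.sum_congr rfl fun μ _ => ?_
        rw [← Summable.tsum_sub (h1 μ) (h0 μ)]
        exact tsum_congr fun z => by ring
    _ = ∑ μ, (∑' z, P μ ν (z - unitVec μ) * g z - ∑' z, P μ ν z * g z) := by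
        simp_rw [hshift]
    _ = ∑ μ, ∑' z, (P μ ν (z - unitVec μ) - P μ ν z) * g z := by
        refine Finset.sum_congr rfl fun μ _ => ?_
        rw [← Summable.tsum_sub (hsum μ) (h0 μ)]
        exact tsum_congr fun z => by ring
    _ = ∑' z, ∑ μ, (P μ ν (z - unitVec μ) - P μ ν z) * g z := by
        rw [Summable.tsum_finsetSum]
        intro μ _
        exact ((hsum μ).sub (h0 μ)).congr fun z => by ring
    _ = ∑' z, (∑ μ, (P μ ν (z - unitVec μ) - P μ ν z)) * g z := by
        refine tsum_congr fun z => ?_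
        rw [Finset.sum_mul]
    _ = 0 := by simp [hT ν]

/-- Zeroth moments vanish: `Σ_z P_{αν}(z) = 0` (Ward identity tested against the linear weight `z ↦ z_α`).
[folklore] -/
theorem tsum_eq_zero_of_ward {P : B12Beta.Kernel d} (hP : MomentSummable P 3) (hT : WardTransversal P)
    (α ν : Fin d) : ∑' z, P α ν z = 0 := by
  have h0 : ∀ μ, Summable fun z => P μ ν z * (z α : ℝ) := fun μ =>
    hP.summable_mul μ ν 1 fun z => by
      rw [one_mul]; exact (abs_apply_le_size z α).trans (size_le_pow z (by norm_num))
  have h1 : ∀ μ, Summable fun z => P μ ν z * (((z + unitVec μ) α : ℤ) : ℝ) := fun μ =>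
    hP.summable_mul μ ν 2 fun z => by
      calc |(((z + unitVec μ) α : ℤ) : ℝ)| ≤ size (z + unitVec μ) := abs_apply_le_size _ α
        _ ≤ 2 * size z := size_add_unitVec_le z μ
        _ ≤ 2 * size z ^ 3 := by linarith [size_le_pow z (n := 3) (by norm_num)]
  have key := ward_pairing P hT ν (fun z => (z α : ℝ)) h0 h1
  have hdiff : ∀ μ z, (((z + unitVec μ) α : ℤ) : ℝ) - (z α : ℝ) = if μ = α then 1 else 0 := by
    intro μ z
    simp only [Pi.add_apply, unitVec_apply]
    by_cases h : α = μ
    · subst h; simp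
    · simp [h, Ne.symm h]
  simp_rw [hdiff, mul_ite, mul_one, mul_zero] at key
  have hite : ∀ μ, (∑' z, if μ = α then P μ ν z else (0 : ℝ)) = if μ = α then ∑' z, P μ ν z else 0 := by
    intro μ; split_ifs <;> simp
  simp_rw [hite] at key
  simpa using key

/-- The CUBIC Ward identity: testing (5.9) against `g(z) = z_α² z_β` (`α ≠ β`) gives
`2 Σ_z P_{αν}(z) z_α z_β + Σ_z P_{αν}(z) z_β + Σ_z P_{βν}(z) z_α² = 0`. [folklore] -/
theorem cubic_ward_identity {P : B12Beta.Kernel d} (hP : MomentSummable P 3) (hT : WardTransversal P)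
    {α β : Fin d} (hαβ : α ≠ β) (ν : Fin d) :
    2 * ∑' z, P α ν z * ((z α : ℝ) * (z β : ℝ)) + ∑' z, P α ν z * (z β : ℝ)
      + ∑' z, P β ν z * (z α : ℝ) ^ 2 = 0 := by
  let g : (Fin d → ℤ) → ℝ := fun z => (z α : ℝ) ^ 2 * (z β : ℝ)
  have hg : ∀ z : Fin d → ℤ, |(z α : ℝ) ^ 2 * (z β : ℝ)| ≤ 1 * size z ^ 3 := by
    intro z
    rw [abs_mul, abs_pow, one_mul, pow_succ]
    exact mul_le_mul (pow_le_pow_left₀ (abs_nonneg _) (abs_apply_le_size z α) 2)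
      (abs_apply_le_size z β) (abs_nonneg _) (pow_nonneg (size_pos z).le 2)
  have h0 : ∀ μ, Summable fun z => P μ ν z * g z := fun μ => hP.summable_mul μ ν 1 hg
  have h1 : ∀ μ, Summable fun z => P μ ν z * g (z + unitVec μ) := fun μ =>
    hP.summable_mul μ ν 8 fun z => by
      calc |g (z + unitVec μ)| ≤ 1 * size (z + unitVec μ) ^ 3 := hg _
        _ ≤ 1 * (2 * size z) ^ 3 := by
            gcongr
            · exact (size_pos _).le
            · exact size_add_unitVec_le z μ
        _ = 8 * size z ^ 3 := by ring
  have key := ward_pairing P hT ν g h0 h1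
  have hdiff : ∀ μ z, g (z + unitVec μ) - g z
      = (if μ = α then (2 * (z α : ℝ) + 1) * (z β : ℝ) else 0) + (if μ = β then (z α : ℝ) ^ 2 else 0) := by
    intro μ z
    by_cases h1 : μ = α
    · simp [g, h1, hαβ, hαβ.symm]
      ring
    · by_cases h2 : μ = β
      · simp [g, h2, hαβ, hαβ.symm]
        ring
      · simp [g, h1, h2, Ne.symm h1, Ne.symm h2]
  simp_rw [hdiff, mul_add] at key
  -- split the two groups
  have hA : ∀ μ, Summable fun z => P μ ν z * (if μ = α then (2 * (z α : ℝ) + 1) * (z β : ℝ) else 0) := by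
    intro μ
    by_cases h : μ = α
    · simp only [h, if_true]
      exact hP.summable_mul α ν 3 fun z => by
        calc |(2 * (z α : ℝ) + 1) * (z β : ℝ)| = |2 * (z α : ℝ) + 1| * |(z β : ℝ)| := abs_mul _ _
          _ ≤ (3 * size z) * size z := by
              refine mul_le_mul ?_ (abs_apply_le_size z β) (abs_nonneg _) (by linarith [size_pos z])
              calc |2 * (z α : ℝ) + 1| ≤ |2 * (z α : ℝ)| + |(1 : ℝ)| := abs_add_le _ _
                _ = 2 * |(z α : ℝ)| + 1 := by
                    rw [abs_mul, abs_one, abs_of_pos (by norm_num : (0 : ℝ) < 2)]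
                _ ≤ 2 * size z + 1 := by linarith [abs_apply_le_size z α]
                _ ≤ 3 * size z := by linarith [one_le_size z]
          _ = 3 * size z ^ 2 := by ring
          _ ≤ 3 * size z ^ 3 := by
              have := pow_le_pow_right₀ (one_le_size z) (show 2 ≤ 3 by norm_num)
              linarith
    · simp only [h, if_false, mul_zero]; exact summable_zero
  have hB : ∀ μ, Summable fun z => P μ ν z * (if μ = β then (z α : ℝ) ^ 2 else 0) := by
    intro μ
    by_cases h : μ = β
    · simp only [h, if_true]
      exact hP.summable_mul β ν 1 fun z => by
        rw [abs_pow, one_mul]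
        exact (pow_le_pow_left₀ (abs_nonneg _) (abs_apply_le_size z α) 2).trans
          (pow_le_pow_right₀ (one_le_size z) (by norm_num))
    · simp only [h, if_false, mul_zero]; exact summable_zero
  have hsplit : ∀ μ, ∑' z, (P μ ν z * (if μ = α then (2 * (z α : ℝ) + 1) * (z β : ℝ) else 0)
      + P μ ν z * (if μ = β then (z α : ℝ) ^ 2 else 0))
      = (if μ = α then ∑' z, P μ ν z * ((2 * (z α : ℝ) + 1) * (z β : ℝ)) else 0)
        + (if μ = β then ∑' z, P μ ν z * (z α : ℝ) ^ 2 else 0) := by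
    intro μ
    rw [Summable.tsum_add (hA μ) (hB μ)]
    congr 1
    · split_ifs <;> simp
    · split_ifs <;> simp
  simp_rw [hsplit] at key
  rw [Finset.sum_add_distrib, Finset.sum_ite_eq', Finset.sum_ite_eq'] at key
  simp only [Finset.mem_univ, if_true] at key
  -- expand the first group
  have hlin : ∑' z, P α ν z * ((2 * (z α : ℝ) + 1) * (z β : ℝ))
      = 2 * ∑' z, P α ν z * ((z α : ℝ) * (z β : ℝ)) + ∑' z, P α ν z * (z β : ℝ) := by
    have s1 : Summable fun z => P α ν z * ((z α : ℝ) * (z β : ℝ)) :=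
      hP.summable_mul α ν 1 fun z => by
        rw [abs_mul, one_mul, pow_succ, pow_two]
        refine mul_le_mul ?_ (abs_apply_le_size z β) (abs_nonneg _)
          (mul_nonneg (size_pos z).le (size_pos z).le)
        exact (abs_apply_le_size z α).trans (by nlinarith [one_le_size z])
    have s2 : Summable fun z => P α ν z * (z β : ℝ) :=
      hP.summable_mul α ν 1 fun z => by
        rw [one_mul]; exact (abs_apply_le_size z β).trans (size_le_pow z (by norm_num))
    rw [← tsum_mul_left, ← Summable.tsum_add (s1.mul_left 2) s2]
    exact tsum_congr fun z => by ring
  rw [hlin] at key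
  linarith

/-- The same identity in terms of `B12Beta.secondMoment` ((1.22) p. 264), at `ν = β`:
`2 β_{αβ} + Σ_z P_{αβ}(z) z_β + Σ_z P_{ββ}(z) z_α² = 0`. [cite: Balaban1987RG1, (1.22) p.264] -/
theorem two_mul_secondMoment_add {P : B12Beta.Kernel d} (hP : MomentSummable P 3)
    (hT : WardTransversal P) {α β : Fin d} (hαβ : α ≠ β) :
    2 * B12Beta.secondMoment P α β + ∑' z, P α β z * (z β : ℝ) + ∑' z, P β β z * (z α : ℝ) ^ 2 = 0 := by
  have h := cubic_ward_identity hP hT hαβ β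
  have e : B12Beta.secondMoment P α β = ∑' z, P α β z * ((z α : ℝ) * (z β : ℝ)) := by
    unfold B12Beta.secondMoment
    exact tsum_congr fun z => by ring
  rw [e]; exact h

/-! ## §3 The first moment vanishes under the reflection covariance (5.7)–(5.8) -/

/-- `Σ_z P_{αβ}(z) z_β = 0` for `α ≠ β`: the substitution `z ↦ εz − e_α` (a bijection of `ℤ^d`) flips the sign
of `P_{αβ}` by (5.7)–(5.8) and preserves `z_β`. No summability needed. [folklore] -/
theorem first_moment_eq_zero {P : B12Beta.Kernel d} (hR : AxisReflectionCovariant P) {α β : Fin d}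
    (hαβ : α ≠ β) : ∑' z, P α β z * (z β : ℝ) = 0 := by
  let φ : (Fin d → ℤ) ≃ (Fin d → ℤ) :=
    { toFun := fun z => axisReflect α z - unitVec α
      invFun := fun w => axisReflect α (w + unitVec α)
      left_inv := fun z => by simp only [sub_add_cancel, axisReflect_axisReflect]
      right_inv := fun w => by simp only [axisReflect_axisReflect, add_sub_cancel_right] }
  have hP : ∀ z, P α β (φ z) = -P α β z := by
    intro z
    have h := hR α α β z
    simp [reflSign, hαβ.symm] at h
    have e : φ z = axisReflect α z - unitVec α := rfl
    rw [e]; linarith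
  have hφβ : ∀ z, (((φ z) β : ℤ) : ℝ) = (z β : ℝ) := by
    intro z
    have e : φ z = axisReflect α z - unitVec α := rfl
    rw [e]
    simp [hαβ.symm]
  have h := φ.tsum_eq (fun w => P α β w * (w β : ℝ))
  simp only [hP, hφβ] at h
  have h' : ∑' z, -P α β z * (z β : ℝ) = -∑' z, P α β z * (z β : ℝ) := by
    rw [← tsum_neg]; exact tsum_congr fun z => by ring
  linarith

/-! ## §4 Bochner on boxes: `ConvPSD` ⇒ plane-wave positivity of the diagonal entries on `ℤ^d` -/

/-- Overlap count `N_B(z) = #{y ∈ B : z + y ∈ B}` (as a real number). [folklore] -/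
def overlap (B : Finset (Fin d → ℤ)) (z : Fin d → ℤ) : ℝ := ∑ y ∈ B, if z + y ∈ B then 1 else 0

/-- `N_B(z) ≥ 0`. [folklore] -/
theorem overlap_nonneg (B : Finset (Fin d → ℤ)) (z : Fin d → ℤ) : 0 ≤ overlap B z :=
  Finset.sum_nonneg fun y _ => by split_ifs <;> norm_num

/-- `N_B(z) ≤ #B`. [folklore] -/
theorem overlap_le_card (B : Finset (Fin d → ℤ)) (z : Fin d → ℤ) : overlap B z ≤ B.card := by
  unfold overlap
  calc ∑ y ∈ B, (if z + y ∈ B then (1 : ℝ) else 0) ≤ ∑ y ∈ B, (1 : ℝ) :=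
        Finset.sum_le_sum fun y _ => by split_ifs <;> norm_num
    _ = B.card := by simp

/-- `Σ_{x,y ∈ B} G(x − y) = Σ_z G(z) N_B(z)`. [folklore] -/
theorem sum_sum_sub_eq_tsum (B : Finset (Fin d → ℤ)) (G : (Fin d → ℤ) → ℝ) :
    ∑ x ∈ B, ∑ y ∈ B, G (x - y) = ∑' z, G z * overlap B z := by
  have hfin : ∀ y, ∀ z ∉ B.image (fun x => x - y), (if z + y ∈ B then G z else 0) = 0 := by
    intro y z hz
    rw [if_neg]
    intro h
    exact hz (Finset.mem_image.mpr ⟨z + y, h, add_sub_cancel_right z y⟩)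
  have hinner : ∀ y ∈ B, ∑ x ∈ B, G (x - y) = ∑' z, (if z + y ∈ B then G z else 0) := by
    intro y _
    rw [tsum_eq_sum (s := B.image (fun x => x - y)) (hfin y),
      Finset.sum_image (fun x _ x' _ h => sub_left_injective h)]
    refine Finset.sum_congr rfl fun x hx => ?_
    rw [if_pos (by simpa using hx)]
  rw [Finset.sum_comm, Finset.sum_congr rfl hinner,
    ← Summable.tsum_finsetSum (fun y _ => summable_of_ne_finset_zero (hfin y))]
  refine tsum_congr fun z => ?_
  rw [overlap, Finset.mul_sum]
  refine Finset.sum_congr rfl fun y _ => ?_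
  split_ifs <;> simp

/-- The cube `B_R = {z ∈ ℤ^d : |z_i| ≤ R}`. [folklore] -/
noncomputable def box (d R : ℕ) : Finset (Fin d → ℤ) := Fintype.piFinset fun _ : Fin d => Finset.Icc (-(R : ℤ)) R

/-- Membership in the cube. [folklore] -/
theorem mem_box {R : ℕ} {z : Fin d → ℤ} : z ∈ box d R ↔ ∀ i, |z i| ≤ R := by
  simp [box, Fintype.mem_piFinset, abs_le]

/-- `#B_R = (2R+1)^d`. [folklore] -/
theorem card_box (R : ℕ) : ((box d R).card : ℝ) = (2 * R + 1 : ℝ) ^ d := by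
  rw [box, Fintype.card_piFinset]
  simp only [Int.card_Icc, Finset.prod_const, Finset.card_univ, Fintype.card_fin]
  have : ((R : ℤ) + 1 - -(R : ℤ)).toNat = 2 * R + 1 := by omega
  rw [this]; push_cast; ring

/-- `#B_R > 0`. [folklore] -/
theorem card_box_pos (R : ℕ) : (0 : ℝ) < (box d R).card := by
  rw [card_box]; positivity

/-- Every lattice point lies in some cube `B_m`. [folklore] -/
theorem exists_mem_box (z : Fin d → ℤ) : ∃ m : ℕ, z ∈ box d m := by
  refine ⟨∑ i, (z i).natAbs, mem_box.mpr fun i => ?_⟩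
  have h : (z i).natAbs ≤ ∑ j, (z j).natAbs :=
    Finset.single_le_sum (f := fun j => (z j).natAbs) (fun j _ => Nat.zero_le _) (Finset.mem_univ i)
  calc |z i| = ((z i).natAbs : ℤ) := (Int.natCast_natAbs (z i)).symm
    _ ≤ ((∑ j, (z j).natAbs : ℕ) : ℤ) := by exact_mod_cast h

/-- For `z ∈ B_m` and `m ≤ R`, every `y ∈ B_{R−m}` has `z + y ∈ B_R`: `#B_{R−m} ≤ N_{B_R}(z)`. [folklore] -/
theorem card_box_le_overlap {m R : ℕ} (hmR : m ≤ R) {z : Fin d → ℤ} (hz : z ∈ box d m) :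
    ((box d (R - m)).card : ℝ) ≤ overlap (box d R) z := by
  have hsub : box d (R - m) ⊆ box d R := by
    intro y hy
    rw [mem_box] at hy ⊢
    intro i
    exact (hy i).trans (by exact_mod_cast Nat.sub_le R m)
  have hz' := mem_box.mp hz
  unfold overlap
  calc ((box d (R - m)).card : ℝ) = ∑ y ∈ box d (R - m), (1 : ℝ) := by simp
    _ = ∑ y ∈ box d (R - m), (if z + y ∈ box d R then (1 : ℝ) else 0) := by
        refine Finset.sum_congr rfl fun y hy => ?_
        rw [if_pos]
        rw [mem_box] at hy ⊢
        intro i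
        have h1 := hz' i
        have h2 := hy i
        have h3 : ((R - m : ℕ) : ℤ) = (R : ℤ) - m := by omega
        calc |(z + y) i| = |z i + y i| := rfl
          _ ≤ |z i| + |y i| := abs_add_le _ _
          _ ≤ (m : ℤ) + ((R - m : ℕ) : ℤ) := add_le_add h1 h2
          _ = R := by omega
    _ ≤ ∑ y ∈ box d R, (if z + y ∈ box d R then (1 : ℝ) else 0) :=
        Finset.sum_le_sum_of_subset_of_nonneg hsub fun y _ _ => by split_ifs <;> norm_num

/-- `N_{B_R}(z)/#B_R → 1` as `R → ∞` (Følner property of cubes). [folklore] -/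
theorem tendsto_overlap_div_card (z : Fin d → ℤ) :
    Tendsto (fun R : ℕ => overlap (box d R) z / (box d R).card) atTop (𝓝 1) := by
  obtain ⟨m, hm⟩ := exists_mem_box z
  have hlow : ∀ᶠ R : ℕ in atTop,
      (((2 * R + 1 - 2 * m) / (2 * R + 1) : ℝ)) ^ d ≤ overlap (box d R) z / (box d R).card := by
    filter_upwards [eventually_ge_atTop m] with R hR
    rw [le_div_iff₀ (card_box_pos R), card_box]
    have h := card_box_le_overlap hR hm
    rw [card_box] at h
    have hne : (2 * (R : ℝ) + 1) ≠ 0 := by positivity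
    calc (((2 * R + 1 - 2 * m) / (2 * R + 1) : ℝ)) ^ d * (2 * R + 1) ^ d
        = ((2 * R + 1 - 2 * m : ℝ)) ^ d := by
          rw [div_pow, div_mul_cancel₀]
          exact pow_ne_zero _ hne
      _ = (2 * ((R - m : ℕ) : ℝ) + 1) ^ d := by rw [Nat.cast_sub hR]; ring
      _ ≤ _ := h
  have hup : ∀ R : ℕ, overlap (box d R) z / (box d R).card ≤ 1 := fun R => by
    rw [div_le_one (card_box_pos R)]; exact overlap_le_card _ _
  have hlim : Tendsto (fun R : ℕ => (((2 * R + 1 - 2 * m) / (2 * R + 1) : ℝ)) ^ d) atTop (𝓝 1) := by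
    have h1 : Tendsto (fun R : ℕ => (2 * (R : ℝ) + 1)) atTop atTop := by
      refine Tendsto.atTop_add ?_ tendsto_const_nhds
      exact tendsto_natCast_atTop_atTop.const_mul_atTop (by norm_num : (0 : ℝ) < 2)
    have h2 : Tendsto (fun R : ℕ => (2 * m : ℝ) / (2 * R + 1)) atTop (𝓝 0) :=
      tendsto_const_nhds.div_atTop h1
    have h3 : Tendsto (fun R : ℕ => (1 - (2 * m : ℝ) / (2 * R + 1)) ^ d) atTop (𝓝 ((1 - 0) ^ d)) :=
      (tendsto_const_nhds.sub h2).pow d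
    rw [sub_zero, one_pow] at h3
    refine h3.congr fun R => ?_
    have hne : (2 * (R : ℝ) + 1) ≠ 0 := by positivity
    have e : (1 - (2 * m : ℝ) / (2 * R + 1)) = (2 * R + 1 - 2 * m) / (2 * R + 1) := by
      rw [eq_div_iff hne, sub_mul, div_mul_cancel₀ _ hne, one_mul]
    rw [e]
  exact tendsto_of_tendsto_of_tendsto_of_le_of_le' hlim tendsto_const_nhds hlow (Eventually.of_forall hup)

/-- Collapse of the `ConvPSD` form on a test function supported on ONE direction index `β`. [folklore] -/
theorem convForm_single_dir (P : B12Beta.Kernel d) (B : Finset (Fin d → ℤ)) (c : (Fin d → ℤ) → ℝ)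
    (β : Fin d) :
    ∑ x ∈ B, ∑ y ∈ B, ∑ μ, ∑ ν,
        (if μ = β then c x else 0) * P μ ν (x - y) * (if ν = β then c y else 0)
      = ∑ x ∈ B, ∑ y ∈ B, c x * P β β (x - y) * c y := by
  refine Finset.sum_congr rfl fun x _ => Finset.sum_congr rfl fun y _ => ?_
  simp [ite_mul, mul_ite]

/-- BOCHNER, discrete and elementary: if the convolution form is PSD then, for every diagonal entry `P_{ββ}` and every
plane wave along an axis `α`, `0 ≤ Σ_z P_{ββ}(z) cos(p z_α)` (test functions `cos(p x_α) e_β`, `sin(p x_α) e_β` on the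
cubes `B_R`, then `R → ∞` by dominated convergence). [folklore] -/
theorem bochner_diag_cos {P : B12Beta.Kernel d} (hPSD : ConvPSD P) (β α : Fin d)
    (hS : Summable fun z => |P β β z|) (p : ℝ) :
    0 ≤ ∑' z, P β β z * Real.cos (p * z α) := by
  -- Step 1: the box sums are nonnegative
  have hbox : ∀ B : Finset (Fin d → ℤ),
      0 ≤ ∑ x ∈ B, ∑ y ∈ B, P β β (x - y) * Real.cos (p * ((x - y) α : ℤ)) := by
    intro B
    have hc := hPSD B (fun x ν => if ν = β then Real.cos (p * x α) else 0)
    have hs := hPSD B (fun x ν => if ν = β then Real.sin (p * x α) else 0)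
    rw [convForm_single_dir] at hc hs
    have e : ∑ x ∈ B, ∑ y ∈ B, P β β (x - y) * Real.cos (p * ((x - y) α : ℤ))
        = ∑ x ∈ B, ∑ y ∈ B, Real.cos (p * x α) * P β β (x - y) * Real.cos (p * y α)
          + ∑ x ∈ B, ∑ y ∈ B, Real.sin (p * x α) * P β β (x - y) * Real.sin (p * y α) := by
      rw [← Finset.sum_add_distrib]
      refine Finset.sum_congr rfl fun x _ => ?_
      rw [← Finset.sum_add_distrib]
      refine Finset.sum_congr rfl fun y _ => ?_
      rw [Pi.sub_apply, Int.cast_sub, mul_sub, Real.cos_sub]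
      ring
    rw [e]
    exact add_nonneg hc hs
  -- Step 2: divide by the volume and let R → ∞
  set G : (Fin d → ℤ) → ℝ := fun z => P β β z * Real.cos (p * z α) with hG
  have hGbound : ∀ z, |G z| ≤ |P β β z| := fun z => by
    rw [hG, abs_mul]
    exact mul_le_of_le_one_right (abs_nonneg _) (Real.abs_cos_le_one _)
  have hlim : Tendsto (fun R : ℕ => ∑' z, G z * (overlap (box d R) z / (box d R).card)) atTop
      (𝓝 (∑' z, G z * 1)) := by
    refine tendsto_tsum_of_dominated_convergence (bound := fun z => |P β β z|) hS (fun z => ?_) ?_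
    · exact tendsto_const_nhds.mul (tendsto_overlap_div_card z)
    · refine Eventually.of_forall fun R z => ?_
      have hq : 0 ≤ overlap (box d R) z / (box d R).card :=
        div_nonneg (overlap_nonneg _ _) (Nat.cast_nonneg _)
      rw [Real.norm_eq_abs, abs_mul, abs_of_nonneg hq]
      calc |G z| * (overlap (box d R) z / (box d R).card) ≤ |P β β z| * 1 :=
            mul_le_mul (hGbound z) ((div_le_one (card_box_pos R)).mpr (overlap_le_card _ _)) hq
              (abs_nonneg _)
        _ = |P β β z| := mul_one _
  simp only [mul_one] at hlim
  refine ge_of_tendsto hlim (Eventually.of_forall fun R => ?_)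
  have e : ∑' z, G z * (overlap (box d R) z / (box d R).card)
      = (∑ x ∈ box d R, ∑ y ∈ box d R, G (x - y)) / (box d R).card := by
    rw [sum_sum_sub_eq_tsum, ← tsum_div_const]
    exact tsum_congr fun z => by ring
  rw [e]
  exact div_nonneg (hbox _) (Nat.cast_nonneg _)

/-! ## §5 From plane-wave positivity and `Σ_z Q(z) = 0` to the sign of the second moment -/

/-- The weight `x²/2 · sinc(px/2)²`; equals `(1 − cos(px))/p²` for `p ≠ 0` and `x²/2` at `p = 0`. [folklore] -/
noncomputable def cosWeight (p x : ℝ) : ℝ := x ^ 2 / 2 * Real.sinc (p * x / 2) ^ 2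

/-- `cosWeight 0 x = x²/2`. [folklore] -/
theorem cosWeight_zero (x : ℝ) : cosWeight 0 x = x ^ 2 / 2 := by
  simp [cosWeight, Real.sinc_zero]

/-- `p² · cosWeight p x = 1 − cos(px)` (half-angle formula). [folklore] -/
theorem sq_mul_cosWeight (p x : ℝ) : p ^ 2 * cosWeight p x = 1 - Real.cos (p * x) := by
  unfold cosWeight
  by_cases h : p * x / 2 = 0
  · have hpx : p * x = 0 := by linarith
    rcases mul_eq_zero.mp hpx with hp | hx
    · simp [hp]
    · simp [hx]
  · have hp : p ≠ 0 := by rintro rfl; simp at h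
    have hx : x ≠ 0 := by rintro rfl; simp at h
    rw [Real.sinc_of_ne_zero h]
    have hcos : Real.cos (p * x) = 1 - 2 * Real.sin (p * x / 2) ^ 2 := by
      have h2 := Real.sin_sq_eq_half_sub (p * x / 2)
      rw [show 2 * (p * x / 2) = p * x by ring] at h2
      linarith
    rw [hcos, div_pow]
    field_simp
    ring

/-- `cosWeight ≥ 0`. [folklore] -/
theorem cosWeight_nonneg (p x : ℝ) : 0 ≤ cosWeight p x := by
  unfold cosWeight; positivity

/-- `cosWeight p x ≤ x²/2` (`|sinc| ≤ 1`). [folklore] -/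
theorem cosWeight_le (p x : ℝ) : cosWeight p x ≤ x ^ 2 / 2 := by
  unfold cosWeight
  have h1 : Real.sinc (p * x / 2) ^ 2 ≤ 1 := by
    have := Real.abs_sinc_le_one (p * x / 2)
    rw [← sq_abs]
    exact pow_le_one₀ (abs_nonneg _) this
  have h0 : 0 ≤ x ^ 2 / 2 := by positivity
  exact mul_le_of_le_one_right h0 h1

/-- `|cosWeight p x| ≤ x²/2`. [folklore] -/
theorem abs_cosWeight_le (p x : ℝ) : |cosWeight p x| ≤ x ^ 2 / 2 := by
  rw [abs_of_nonneg (cosWeight_nonneg p x)]; exact cosWeight_le p x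

/-- `p ↦ cosWeight p x` is continuous (`Real.continuous_sinc`). [folklore] -/
theorem continuous_cosWeight (x : ℝ) : Continuous fun p => cosWeight p x := by
  unfold cosWeight
  exact continuous_const.mul ((Real.continuous_sinc.comp (by fun_prop)).pow 2)

/-- If `Q` is absolutely summable with a second moment along the axis `α`, `Σ_z Q(z) = 0` and all plane-wave sums
`Σ_z Q(z) cos(p z_α)` are `≥ 0`, then `Σ_z Q(z) z_α² ≤ 0`.  Proof: `Σ_z Q(z)(1 − cos(p z_α))/p² ≤ 0` for `p ≠ 0` and
`(1 − cos(px))/p² = (x²/2) sinc(px/2)² → x²/2` dominatedly (Tannery) as `p → 0`. [folklore] -/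
theorem weighted_second_moment_nonpos (Q : (Fin d → ℤ) → ℝ) (α : Fin d)
    (hQ : Summable fun z => |Q z|) (h2 : Summable fun z => |Q z| * (z α : ℝ) ^ 2)
    (h0 : ∑' z, Q z = 0) (hB : ∀ p : ℝ, 0 ≤ ∑' z, Q z * Real.cos (p * z α)) :
    ∑' z, Q z * (z α : ℝ) ^ 2 ≤ 0 := by
  have hQ' : Summable Q := Summable.of_norm_bounded hQ (fun z => le_rfl)
  have hcos : ∀ p : ℝ, Summable fun z => Q z * Real.cos (p * z α) := fun p =>
    Summable.of_norm_bounded hQ fun z => by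
      rw [Real.norm_eq_abs, abs_mul]
      exact mul_le_of_le_one_right (abs_nonneg _) (Real.abs_cos_le_one _)
  have hneg : ∀ p : ℝ, p ≠ 0 → ∑' z, Q z * cosWeight p (z α) ≤ 0 := by
    intro p hp
    have hp2 : (0 : ℝ) < p ^ 2 := by positivity
    have e1 : ∑' z, Q z * cosWeight p (z α) = (p ^ 2)⁻¹ * ∑' z, Q z * (1 - Real.cos (p * z α)) := by
      rw [← tsum_mul_left]
      refine tsum_congr fun z => ?_
      rw [← sq_mul_cosWeight]
      field_simp
    have e2 : ∑' z, Q z * (1 - Real.cos (p * z α)) = ∑' z, Q z - ∑' z, Q z * Real.cos (p * z α) := by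
      rw [← Summable.tsum_sub hQ' (hcos p)]
      exact tsum_congr fun z => by ring
    rw [e1, e2, h0, zero_sub]
    have := hB p
    have hinv : 0 ≤ (p ^ 2)⁻¹ := inv_nonneg.mpr hp2.le
    nlinarith
  have hlim : Tendsto (fun p : ℝ => ∑' z, Q z * cosWeight p (z α)) (𝓝[≠] 0)
      (𝓝 (∑' z, Q z * ((z α : ℝ) ^ 2 / 2))) := by
    refine tendsto_tsum_of_dominated_convergence (bound := fun z => |Q z| * (z α : ℝ) ^ 2 / 2) ?_
      (fun z => ?_) ?_
    · simpa [mul_div_assoc] using h2.div_const 2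
    · have hc : Continuous fun p : ℝ => Q z * cosWeight p (z α) :=
        continuous_const.mul (continuous_cosWeight _)
      have ht := hc.tendsto 0
      rw [cosWeight_zero] at ht
      exact ht.mono_left nhdsWithin_le_nhds
    · refine Eventually.of_forall fun p z => ?_
      rw [Real.norm_eq_abs, abs_mul]
      calc |Q z| * |cosWeight p (z α)| ≤ |Q z| * ((z α : ℝ) ^ 2 / 2) :=
            mul_le_mul_of_nonneg_left (abs_cosWeight_le _ _) (abs_nonneg _)
        _ = |Q z| * (z α : ℝ) ^ 2 / 2 := by ring
  have hle : ∑' z, Q z * ((z α : ℝ) ^ 2 / 2) ≤ 0 :=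
    le_of_tendsto hlim (eventually_nhdsWithin_of_forall fun p hp => hneg p hp)
  have e : ∑' z, Q z * ((z α : ℝ) ^ 2 / 2) = (∑' z, Q z * (z α : ℝ) ^ 2) / 2 := by
    rw [← tsum_div_const]
    exact tsum_congr fun z => by ring
  rw [e] at hle
  linarith

/-! ## §6 Lemma 5.2 / Lemma T, conclusion: `β = Σ_x Π_{αβ}(x) x_α x_β ≥ 0` -/

/-- Moments summable ⇒ `Σ_z |P_{μν}(z)| < ∞`. [folklore] -/
theorem MomentSummable.summable_abs {P : B12Beta.Kernel d} {n : ℕ} (hP : MomentSummable P n) (μ ν : Fin d) :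
    Summable fun z => |P μ ν z| :=
  Summable.of_nonneg_of_le (fun _ => abs_nonneg _)
    (fun z => le_mul_of_one_le_right (abs_nonneg _) (one_le_pow₀ (one_le_size z))) (hP μ ν)

/-- Third moments summable ⇒ `Σ_z |P_{μν}(z)| z_α² < ∞`. [folklore] -/
theorem MomentSummable.summable_abs_mul_sq {P : B12Beta.Kernel d} (hP : MomentSummable P 3)
    (μ ν α : Fin d) : Summable fun z => |P μ ν z| * (z α : ℝ) ^ 2 := by
  refine Summable.of_nonneg_of_le (fun z => by positivity) (fun z => ?_) (hP μ ν)
  refine mul_le_mul_of_nonneg_left ?_ (abs_nonneg _)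
  calc (z α : ℝ) ^ 2 = |(z α : ℝ)| ^ 2 := (sq_abs _).symm
    _ ≤ size z ^ 2 := pow_le_pow_left₀ (abs_nonneg _) (abs_apply_le_size z α) 2
    _ ≤ size z ^ 3 := pow_le_pow_right₀ (one_le_size z) (by norm_num)

/-- The diagonal second moments along a transverse axis are `≤ 0`:  `Σ_z Π_{ββ}(z) z_α² ≤ 0` — from PSD (Bochner on
boxes), the Ward identity (zeroth moment `Σ_z Π_{ββ}(z) = 0`) and summable third moments. [folklore] -/
theorem diag_second_moment_nonpos {P : B12Beta.Kernel d} (hP : MomentSummable P 3) (hT : WardTransversal P)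
    (hPSD : ConvPSD P) (α β : Fin d) : ∑' z, P β β z * (z α : ℝ) ^ 2 ≤ 0 :=
  weighted_second_moment_nonpos (P β β) α (hP.summable_abs β β) (hP.summable_abs_mul_sq β β α)
    (tsum_eq_zero_of_ward hP hT β β) (bochner_diag_cos hPSD β α (hP.summable_abs β β))

/-- (1.22) rewritten by the cubic Ward identity: if the first moment `Σ_z Π_{αβ}(z) z_β` vanishes (e.g. by the
reflection covariance (5.7)–(5.8), `first_moment_eq_zero`), then `β = Σ_z Π_{αβ}(z) z_α z_β = −½ Σ_z Π_{ββ}(z) z_α²`.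
[cite: Balaban1987RG1, (1.22) p.264] -/
theorem secondMoment_eq_neg_half {P : B12Beta.Kernel d} (hP : MomentSummable P 3) (hT : WardTransversal P)
    {α β : Fin d} (hαβ : α ≠ β) (hm1 : ∑' z, P α β z * (z β : ℝ) = 0) :
    B12Beta.secondMoment P α β = -(1 / 2) * ∑' z, P β β z * (z α : ℝ) ^ 2 := by
  have h := two_mul_secondMoment_add hP hT hαβ
  rw [hm1] at h
  linarith

/-- The β sub-cell's "Lemma 5.2" (`BETA/AN2-pv09.md`, programme-internal numbering; = Lemma T of `BETA/AN2.md`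
§4.2) — its CONCLUSION "β ≥ 0", PROVED for any kernel with the stated properties (B12 p. 293 context: *"We will analyze
this function using the above properties only. Our goal is to prove a representation … of the form (5.16) and to find
the coefficient β."*): PSD convolution form, Ward transversality (5.9), summable third moments (from (5.10)) and
vanishing first moment `Σ_z Π_{αβ}(z) z_β = 0` (from (5.7)–(5.8)) imply `0 ≤ β = Σ_x Π_{αβ}(x) x_α x_β` ((1.22)
p. 264), `α ≠ β`. [cite: Balaban1987RG1, (5.9) p.293] -/
theorem secondMoment_nonneg {P : B12Beta.Kernel d} (hP : MomentSummable P 3) (hT : WardTransversal P)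
    (hPSD : ConvPSD P) {α β : Fin d} (hαβ : α ≠ β) (hm1 : ∑' z, P α β z * (z β : ℝ) = 0) :
    0 ≤ B12Beta.secondMoment P α β := by
  rw [secondMoment_eq_neg_half hP hT hαβ hm1]
  have h := diag_second_moment_nonpos hP hT hPSD α β
  nlinarith

/-- The same with the first-moment hypothesis discharged by the single-axis reflection covariance (5.7)–(5.8).
[cite: Balaban1987RG1, (5.7) p.293] -/
theorem secondMoment_nonneg_of_reflection {P : B12Beta.Kernel d} (hP : MomentSummable P 3)
    (hT : WardTransversal P) (hPSD : ConvPSD P) (hR : AxisReflectionCovariant P) {α β : Fin d}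
    (hαβ : α ≠ β) : 0 ≤ B12Beta.secondMoment P α β :=
  secondMoment_nonneg hP hT hPSD hαβ (first_moment_eq_zero hR hαβ)

/-- The symmetric form of the coefficient under (5.7)–(5.9): `β = −¼ Σ_z (Π_{ββ}(z) z_α² + Π_{αα}(z) z_β²)`,
`α ≠ β`. [cite: Balaban1987RG1, (1.22) p.264] -/
theorem secondMoment_eq_neg_quarter {P : B12Beta.Kernel d} (hP : MomentSummable P 3) (hT : WardTransversal P)
    (hS : IndexSymmetric P) (hR : AxisReflectionCovariant P) {α β : Fin d} (hαβ : α ≠ β) :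
    B12Beta.secondMoment P α β
      = -(1 / 4) * (∑' z, P β β z * (z α : ℝ) ^ 2 + ∑' z, P α α z * (z β : ℝ) ^ 2) := by
  have h1 := secondMoment_eq_neg_half hP hT hαβ (first_moment_eq_zero hR hαβ)
  have h2 := secondMoment_eq_neg_half hP hT hαβ.symm (first_moment_eq_zero hR hαβ.symm)
  have h3 := secondMoment_comm hS α β
  linarith

/-! ## §7 Edges by name: (5.10) `B12Sec2to5.Decay510` ⇒ moment summability; Lemma 5.2 ⇒ `Step.BetaLower 0` -/

/-- `size = 1 + |·|₁` with the cell's `B12Sec2to5.l1`. [folklore] -/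
theorem size_eq_one_add_l1 (z : Fin d → ℤ) : size z = 1 + B12Sec2to5.l1 z := rfl

/-- `(1+s)^n e^{−δ s} ≤ (n!·e^{δ/2}/(δ/2)^n)·e^{−(δ/2)s}` for `s ≥ 0`, `δ > 0` (from `t^n/n! ≤ e^t`). [folklore] -/
theorem one_add_pow_mul_exp_neg_le {δ : ℝ} (hδ : 0 < δ) (n : ℕ) {s : ℝ} (hs : 0 ≤ s) :
    (1 + s) ^ n * Real.exp (-δ * s)
      ≤ ((n.factorial : ℝ) * Real.exp (δ / 2) / (δ / 2) ^ n) * Real.exp (-(δ / 2) * s) := by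
  have hδ2 : 0 < δ / 2 := half_pos hδ
  have hpow : 0 < (δ / 2) ^ n := pow_pos hδ2 n
  have hfact : (0 : ℝ) < (n.factorial : ℝ) := by exact_mod_cast Nat.factorial_pos n
  have ht : 0 ≤ δ / 2 * (1 + s) := by positivity
  have h1 : (δ / 2 * (1 + s)) ^ n / (n.factorial : ℝ) ≤ Real.exp (δ / 2 * (1 + s)) :=
    Real.pow_div_factorial_le_exp _ ht n
  rw [div_le_iff₀ hfact, mul_pow] at h1
  have h2 : (1 + s) ^ n ≤ (n.factorial : ℝ) / (δ / 2) ^ n * Real.exp (δ / 2 * (1 + s)) := by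
    calc (1 + s) ^ n = ((δ / 2) ^ n * (1 + s) ^ n) / (δ / 2) ^ n := (mul_div_cancel_left₀ _ hpow.ne').symm
      _ ≤ (Real.exp (δ / 2 * (1 + s)) * (n.factorial : ℝ)) / (δ / 2) ^ n := div_le_div_of_nonneg_right h1 hpow.le
      _ = (n.factorial : ℝ) / (δ / 2) ^ n * Real.exp (δ / 2 * (1 + s)) := by ring
  have h3 : Real.exp (δ / 2 * (1 + s)) * Real.exp (-δ * s) = Real.exp (δ / 2) * Real.exp (-(δ / 2) * s) := by
    rw [← Real.exp_add, ← Real.exp_add]; ring_nf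
  calc (1 + s) ^ n * Real.exp (-δ * s)
      ≤ ((n.factorial : ℝ) / (δ / 2) ^ n * Real.exp (δ / 2 * (1 + s))) * Real.exp (-δ * s) :=
        mul_le_mul_of_nonneg_right h2 (Real.exp_pos _).le
    _ = (n.factorial : ℝ) / (δ / 2) ^ n * (Real.exp (δ / 2 * (1 + s)) * Real.exp (-δ * s)) := by ring
    _ = ((n.factorial : ℝ) * Real.exp (δ / 2) / (δ / 2) ^ n) * Real.exp (-(δ / 2) * s) := by rw [h3]; ring

/-- The exponential decay (5.10), in the cell's typing `B12Sec2to5.Decay510 (P μ ν) C δ₁` for every component, gives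
all polynomial moments: `MomentSummable P n` for every `n`. [cite: Balaban1987RG1, (5.10) p.293] -/
theorem momentSummable_of_decay510 {P : B12Beta.Kernel d} {C δ₁ : ℝ} (hδ : 0 < δ₁)
    (hdec : ∀ μ ν, B12Sec2to5.Decay510 (P μ ν) C δ₁) (n : ℕ) : MomentSummable P n := by
  intro μ ν
  have hC : 0 ≤ C := by
    have h := hdec μ ν 0
    have he : 0 < Real.exp (-δ₁ * B12Sec2to5.l1 (0 : Fin d → ℤ)) := Real.exp_pos _
    exact (mul_nonneg_iff_of_pos_right he).mp ((abs_nonneg _).trans h)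
  set K : ℝ := (n.factorial : ℝ) * Real.exp (δ₁ / 2) / (δ₁ / 2) ^ n with hK
  refine Summable.of_nonneg_of_le (fun z => mul_nonneg (abs_nonneg _) (pow_nonneg (size_pos z).le n))
    (fun z => ?_) ((B12Sec2to5.summable_exp_neg_l1 (half_pos hδ) d).mul_left (C * K))
  have h1 := hdec μ ν z
  have h2 := one_add_pow_mul_exp_neg_le hδ n (B12Sec2to5.l1_nonneg z)
  rw [size_eq_one_add_l1]
  calc |P μ ν z| * (1 + B12Sec2to5.l1 z) ^ n
      ≤ C * Real.exp (-δ₁ * B12Sec2to5.l1 z) * (1 + B12Sec2to5.l1 z) ^ n :=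
        mul_le_mul_of_nonneg_right h1 (pow_nonneg (by linarith [B12Sec2to5.l1_nonneg z]) n)
    _ = C * ((1 + B12Sec2to5.l1 z) ^ n * Real.exp (-δ₁ * B12Sec2to5.l1 z)) := by ring
    _ ≤ C * (K * Real.exp (-(δ₁ / 2) * B12Sec2to5.l1 z)) := mul_le_mul_of_nonneg_left (by rw [hK]; exact h2) hC
    _ = C * K * Real.exp (-(δ₁ / 2) * B12Sec2to5.l1 z) := by ring

/-- Lemma 5.2's sign with the summability hypothesis discharged by (5.10) `Decay510`.
[cite: Balaban1987RG1, (5.10) p.293] -/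
theorem secondMoment_nonneg_of_decay510 {P : B12Beta.Kernel d} {C δ₁ : ℝ} (hδ : 0 < δ₁)
    (hdec : ∀ μ ν, B12Sec2to5.Decay510 (P μ ν) C δ₁) (hT : WardTransversal P) (hPSD : ConvPSD P)
    (hR : AxisReflectionCovariant P) {α β : Fin d} (hαβ : α ≠ β) : 0 ≤ B12Beta.secondMoment P α β :=
  secondMoment_nonneg_of_reflection (momentSummable_of_decay510 hδ hdec 3) hT hPSD hR hαβ

/-- **Edge §5 (Lemma 5.2) → `Step.BetaLower 0`.**  If the β-functions of a flow are given by (5.42) = (1.22) from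
kernels `Π^{(j)}(g, ·)` which, for `g` in the coupling interval `]0, γ]`, obey (5.10) (every component), the Ward
identity (5.9), the reflection covariance (5.7)–(5.8) and have a PSD convolution form, then `β_j(g) ≥ 0` on `]0, γ]`,
i.e. `Step.BetaLower 0 γ β` — the hypothesis of `Step.B14_2_6d_of_betaNonneg`.  Compare
`B12Sec2to5.betaLower_neg_of_decay510` (from (5.10) ALONE only `BetaLower (−β′)`).  The POSITIVE lower bound `b > 0`
(asymptotic freedom, GAPS G1) is NOT touched. [folklore] -/
theorem betaLower_zero_of_lemma52 (μ ν : Fin d) (hμν : μ ≠ ν) (Pfam : ℕ → ℝ → B12Beta.Kernel d)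
    (β : ℕ → ℝ → ℝ) {γ C δ₁ : ℝ} (hδ : 0 < δ₁)
    (hβ : ∀ j g, β j g = B12Beta.secondMoment (Pfam j g) μ ν)
    (hdec : ∀ j g, 0 < g → g ≤ γ → ∀ μ' ν', B12Sec2to5.Decay510 (Pfam j g μ' ν') C δ₁)
    (hT : ∀ j g, 0 < g → g ≤ γ → WardTransversal (Pfam j g))
    (hPSD : ∀ j g, 0 < g → g ≤ γ → ConvPSD (Pfam j g))
    (hR : ∀ j g, 0 < g → g ≤ γ → AxisReflectionCovariant (Pfam j g)) :
    Step.BetaLower 0 γ β := by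
  intro j g hg hgγ
  rw [hβ j g]
  exact secondMoment_nonneg_of_decay510 hδ (hdec j g hg hgγ) (hT j g hg hgγ) (hPSD j g hg hgγ)
    (hR j g hg hgγ) hμν

/-! ## §8 Finite tori `(ℤ/s)^d` ((k3) "finite Fourier"): PSD of the convolution form ⇒ plane-wave positivity -/

section Torus

variable {s : ℕ} [NeZero s]

/-- PSD of the convolution form on the finite torus `(ℤ/s)^d` (`Beta.Site d s`; every test function is finitely
supported).  A PREDICATE. [folklore] -/
def TorusConvPSD (P : Fin d → Fin d → Beta.Site d s → ℝ) : Prop :=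
  ∀ f : Beta.Site d s → Fin d → ℝ, 0 ≤ ∑ x, ∑ y, ∑ μ, ∑ ν, f x μ * P μ ν (x - y) * f y ν

/-- The plane wave (finite Fourier character) `χ_k(z) = exp(2πi (Σ_i k_i z_i)/s)` on `(ℤ/s)^d`. [folklore] -/
noncomputable def planeWave (k z : Beta.Site d s) : ℂ := (ZMod.toCircle (∑ i, k i * z i) : ℂ)

/-- `χ_k(x − y) = χ_k(x) · conj χ_k(y)`. [folklore] -/
theorem planeWave_sub (k x y : Beta.Site d s) :
    planeWave k (x - y) = planeWave k x * (starRingEnd ℂ) (planeWave k y) := by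
  unfold planeWave
  have e : ∑ i, k i * (x - y) i = ∑ i, k i * x i + -(∑ i, k i * y i) := by
    rw [← sub_eq_add_neg, ← Finset.sum_sub_distrib]
    exact Finset.sum_congr rfl fun i _ => by rw [Pi.sub_apply, mul_sub]
  rw [e, AddChar.map_add_eq_mul, AddChar.map_neg_eq_inv, Circle.coe_mul, Circle.coe_inv_eq_conj]

/-- FINITE BOCHNER (easy direction): on the torus, PSD of the convolution form implies that every plane-wave
component of every diagonal quadratic form of the kernel is nonnegative:
`0 ≤ Σ_z Re χ_k(z) · Σ_{μν} e_μ P_{μν}(z) e_ν` (test functions `Re χ_k(x) e`, `Im χ_k(x) e`). [folklore] -/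
theorem torus_planeWave_nonneg {P : Fin d → Fin d → Beta.Site d s → ℝ} (hPSD : TorusConvPSD P)
    (e : Fin d → ℝ) (k : Beta.Site d s) :
    0 ≤ ∑ z, (planeWave k z).re * ∑ μ, ∑ ν, e μ * P μ ν z * e ν := by
  have hc := hPSD (fun x μ => (planeWave k x).re * e μ)
  have hs := hPSD (fun x μ => (planeWave k x).im * e μ)
  have e1 : ∑ x, ∑ y, ∑ μ, ∑ ν, ((planeWave k x).re * e μ) * P μ ν (x - y) * ((planeWave k y).re * e ν)
      + ∑ x, ∑ y, ∑ μ, ∑ ν, ((planeWave k x).im * e μ) * P μ ν (x - y) * ((planeWave k y).im * e ν)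
      = ∑ x, ∑ y : Beta.Site d s, (planeWave k (x - y)).re * ∑ μ, ∑ ν, e μ * P μ ν (x - y) * e ν := by
    rw [← Finset.sum_add_distrib]
    refine Finset.sum_congr rfl fun x _ => ?_
    rw [← Finset.sum_add_distrib]
    refine Finset.sum_congr rfl fun y _ => ?_
    rw [planeWave_sub, Complex.mul_re, Complex.conj_re, Complex.conj_im, Finset.mul_sum,
      ← Finset.sum_add_distrib]
    refine Finset.sum_congr rfl fun μ _ => ?_
    rw [Finset.mul_sum, ← Finset.sum_add_distrib]
    refine Finset.sum_congr rfl fun ν _ => ?_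
    ring
  have e2 : ∑ x, ∑ y : Beta.Site d s, (planeWave k (x - y)).re * ∑ μ, ∑ ν, e μ * P μ ν (x - y) * e ν
      = (Fintype.card (Beta.Site d s) : ℝ) * ∑ z, (planeWave k z).re * ∑ μ, ∑ ν, e μ * P μ ν z * e ν := by
    rw [Finset.sum_comm]
    have h : ∀ y : Beta.Site d s,
        ∑ x, (planeWave k (x - y)).re * ∑ μ, ∑ ν, e μ * P μ ν (x - y) * e ν
          = ∑ z, (planeWave k z).re * ∑ μ, ∑ ν, e μ * P μ ν z * e ν := fun y =>
      Fintype.sum_equiv (Equiv.subRight y) _ _ (fun x => rfl)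
    rw [Finset.sum_congr rfl fun y _ => h y, Finset.sum_const, Finset.card_univ, nsmul_eq_mul]
  have hpos : (0 : ℝ) < Fintype.card (Beta.Site d s) := by exact_mod_cast Fintype.card_pos
  have h := add_nonneg hc hs
  rw [e1, e2] at h
  exact (mul_nonneg_iff_of_pos_left hpos).mp h

end Torus

end Literature.MathematicalPhysics.QuantumFieldTheory.Balaban1983to89.Beta.PolarizationSign
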